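import Summits.QuantumFields.YangMills.Theorems.BalabanUVNodesC44IterMhCone
import Summits.QuantumFields.YangMills.Theorems.BalabanUVNodesC44IterMhLocalityPr
import Summits.QuantumFields.YangMills.Theorems.BalabanUVNodesProp4ColumnsAtRecordPr
import HarnessLib

/-!
# (ℓd)'s (KL-C) AT THE RECORD, FRAMED EDITION (ρ-frame-min) — FROM [B7] PROP. 5 (157)'s PER-ENTRY SHAPE ON THE TWO-BLOCK CONE TO G1ᵖʳ's ONE-BOND COARSE-COLUMN LETTER OF
# `D C^{sl,pr}`, and PROP. 4 at the record (node-00) from (ℓa-H)ᵖʳ + (KL-H)ᵖʳ + (KL-N)ᵖʳ + the ON-CONE entry letter + (14) — twins of ✓`…C44IterMhCone` §2–§3 (the names hand-27238-KLC consumes)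

Cell `pub-ymgap` ∕ `ym-nodeO-ideate`, porter lineage `ymgap-nodeO-port-PTB-1` (gen 9); re-press (B) of director-ym g23 №608 (ROAD WORD FINAL), `…ConePr` §2–§3; filed behind (A2)∕(A3),
F9ᵖʳ ✓`…C44IterMhLocalityPr` and the G-door part 2 ✓`…Prop4ColumnsAtRecordPr`; `--kind proof --supports stmt-QuantumFields-27238 --as helper`; count-neutral; NEW basename, append-nothing
(✓`…C44IterMhCone` stays; its §1 cone geometry — `cone_saturated`, `mem_bondsIn_cone_self`, `sum_indicator_cone_le` — is chart-free and reused verbatim).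
[B7] = [Balaban1985Averaging]; [B11] = [Balaban1985Variational]; [BIII] = [Balaban1985BackgroundPropagators].

RE-KEYING RULE (def-Y PRICE #2 (B)): `CslOfRecord ↦ CslprOfRecord … 𝔥`, `H1OfRecordAtBgFlat ↦ H1prOfRecordAtBg … 𝔥`, `Δπ` at `Q′♭ ↦ QprimeOfRecord U₀`, `Prop4…AtRecord ↦ Prop4…PrAtRecord … 𝔥`,
`C₂ ↦ 3.2·10¹⁶·L·N`; the off-cone vanishing now comes from F9ᵖʳ ✓`equiv_fderiv_CslprOfRecord_single_eq_zero`, hence the two DISPLAYED frame block-locality hypotheses (hmap)∕(hderiv)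
(every region saturated below `k`); the (ℓa-C)ᵖʳ supplier threads `hc`∕(hdom)∕(hnear).  Proofs word for word otherwise.

WHAT IS PROVED (0 def, 0 sorry, axioms standard; ns `Summit.QuantumFields.YangMills.Theorems.C44IterMh`): ★★ `kernelLetterC_of_conePr`, ★★★ `prop4UniformPrAtRecord_node00_of_coneLetterPr`.

HONEST FRAMING.  Glue: the on-cone entry letter `g₀` ([B7] (157)-class), (ℓa-H)ᵖʳ, (KL-H)ᵖʳ, (KL-N)ᵖʳ ((R1)-class), the frame bounds and the frame block-locality are DISPLAYED binders, NOT
proved; no frame is constructed in the tree yet ((A1) is node00-def-Y's); (R1)∕(R2) OPEN; K0ᴬ ⟨stmt-QuantumFields-27238⟩ NOT closed; NODE O 0∕1; COUNT 8∕28 · K 1∕4 UNMOVED; finite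
`𝕋⁴_{L^K}` at fixed ε — NOT continuum ∕ ℝ⁴ ∕ OS ∕ Clay; **the Yang–Mills mass gap (Clay) is NOT proved by any of this.**  No `sorry`, `instance`, `notation`, `set_option`; standard axioms.
-/

noncomputable section

open scoped Matrix Matrix.Norms.L2Operator InnerProductSpace ComplexConjugate Topology BigOperators
open Classical

namespace Summit.QuantumFields.YangMills.Theorems.C44IterMh

open Literature.MathematicalPhysics.QuantumFieldTheory.Balaban1983to89
open Literature.MathematicalPhysics.QuantumFieldTheory.Balaban1983to89.Node00
open T4Continuum BlockAveraging
open B10Eq42TorusConstraint (bondsIn mem_bondsIn_iff)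
open B10Eq38TorusDomains (toFine toFine_zero)
open B9SectCLatticeCarrier (Bond)
open B11Eq103H1Complex (SiteL2K)
open B11Eq115Space (NegSup NegSize levWeight)
open B11Eq90Transpose (single115)
open B11Eq90V0primeCurrent (flat115)
open B11Eq111FrakG (nabla115)
open Summit.QuantumFields.YangMills.Theorems.Prop4UniformAtRecord (prop4UniformPrAtRecord_node00_of_kernelLetters)

section Record

variable (F : T4Family) (N : ℕ) [NeZero N] (K k : ℕ) (Ω : ℕ → Set (Site (F.P K) 0)) (U₀ : GaugeField (F.P K) 0 (SU N))
variable [Fact (0 < (F.L : ℝ))] [Fact (0 < (F.P K).eta k)]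

/-! ## §1  (KL-C)ᵖʳ in G1's binder shape from the per-entry shape on the two-block cone -/

/-- ★★ **(KL-C)ᵖʳ IN G1's BINDER SHAPE FROM [B7] (157)'s PER-ENTRY SHAPE, FRAMED** (twin of ✓`kernelLetterC_of_cone`): under the guard below `k ≤ m + K` and the DISPLAYED frame
block-locality (hmap)∕(hderiv) on every region saturated below `k`, if on a ball `‖A‖ < ρ` the entries of the derivative kernel of `C^{sl,pr}` satisfy `‖(D C^{sl,pr}(A)·δ_b X)(c)‖ ≤ g₀‖A‖‖X‖`
whenever `b` lies in the two-block cone of `c`, then G1's one-bond coarse-column letter holds with `gC(c, b) := g₀·𝟙[b ∈ cone c]` (off the cone the entry is `0`, F9ᵖʳ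
✓`equiv_fderiv_CslprOfRecord_single_eq_zero`) and `Σ_c gC(c, b) ≤ 2d·g₀`. [cite: Balaban1985Averaging, Proposition 5 (157) p.42, p.24; Balaban1985Variational, (73) p.289, (86) p.291] -/
theorem kernelLetterC_of_conePr (hk : k ≤ (F.P K).m + (F.P K).K) (𝔥 : FrameDatum (F.P K) N k U₀) (levB : PBond (F.P K) k → ℕ) (hU₀ : SmallBelow (avOfRecord F N K) k U₀)
    (hmap : ∀ Y : Set (Site (F.P K) 0), (∀ i, i < k → ∀ s : Site (F.P K) i, toFine i s ∈ Y ↔ toFine (i + 1) (blockOf s) ∈ Y) →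
      ∀ V V' : PBond (F.P K) 0 → Matrix (Fin N) (Fin N) ℂ, (∀ b : PBond (F.P K) 0, b ∈ bondsIn 0 Y → V b = V' b) →
      ∀ y : Site (F.P K) k, toFine k y ∈ Y → 𝔥.map V y = 𝔥.map V' y ∧ 𝔥.inv V y = 𝔥.inv V' y)
    (hderiv : ∀ Y : Set (Site (F.P K) 0), (∀ i, i < k → ∀ s : Site (F.P K) i, toFine i s ∈ Y ↔ toFine (i + 1) (blockOf s) ∈ Y) →
      ∀ Z Z' : PBond (F.P K) 0 → Matrix (Fin N) (Fin N) ℂ, (∀ b : PBond (F.P K) 0, b ∈ bondsIn 0 Y → Z b = Z' b) →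
      ∀ y : Site (F.P K) k, toFine k y ∈ Y → 𝔥.deriv Z y = 𝔥.deriv Z' y)
    {ρ g₀ : ℝ} (hg₀ : 0 ≤ g₀)
    (hg : ∀ A : Space115Lit F N K k Ω U₀, ‖A‖ < ρ → ∀ (bb : Bond (F.P K).d (fun _ => (F.P K).sitesPerDir 0)) (X : Matrix (Fin N) (Fin N) ℂ) (c : PBond (F.P K) k),
      (bondToLit (F.P K) 0).symm bb ∈ bondsIn 0 {x : Site (F.P K) 0 | B14.Eq22Determines.blockIter k x = c.src ∨ B14.Eq22Determines.blockIter k x = c.tgt} →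
      ‖NegSup.equiv (levWeight (F.L : ℝ) ((F.P K).eta k) levB 0) (Matrix (Fin N) (Fin N) ℂ)
        (fderiv ℂ (CslprOfRecord F N K k Ω U₀ 𝔥 levB) A
          (single115 (lev₁ := pairLevLit F Ω k) (Dc := nabla115 ((F.P K).eta k) (unitsOfRecord F N U₀)) bb X)) c‖ ≤ g₀ * ‖A‖ * ‖X‖) :
    (∀ (c : PBond (F.P K) k) (bb : Bond (F.P K).d (fun _ => (F.P K).sitesPerDir 0)),
      0 ≤ (if (bondToLit (F.P K) 0).symm bb ∈ bondsIn 0 {x : Site (F.P K) 0 | B14.Eq22Determines.blockIter k x = c.src ∨ B14.Eq22Determines.blockIter k x = c.tgt} then g₀ else 0)) ∧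
    (∀ A : Space115Lit F N K k Ω U₀, ‖A‖ < ρ → ∀ (bb : Bond (F.P K).d (fun _ => (F.P K).sitesPerDir 0)) (X : Matrix (Fin N) (Fin N) ℂ) (c : PBond (F.P K) k),
      ‖NegSup.equiv (levWeight (F.L : ℝ) ((F.P K).eta k) levB 0) (Matrix (Fin N) (Fin N) ℂ)
        (fderiv ℂ (CslprOfRecord F N K k Ω U₀ 𝔥 levB) A
          (single115 (lev₁ := pairLevLit F Ω k) (Dc := nabla115 ((F.P K).eta k) (unitsOfRecord F N U₀)) bb X)) c‖ ≤
        (if (bondToLit (F.P K) 0).symm bb ∈ bondsIn 0 {x : Site (F.P K) 0 | B14.Eq22Determines.blockIter k x = c.src ∨ B14.Eq22Determines.blockIter k x = c.tgt} then g₀ else 0) * ‖A‖ * ‖X‖) ∧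
    (∀ bb : Bond (F.P K).d (fun _ => (F.P K).sitesPerDir 0),
      (∑ c : PBond (F.P K) k, (if (bondToLit (F.P K) 0).symm bb ∈ bondsIn 0 {x : Site (F.P K) 0 | B14.Eq22Determines.blockIter k x = c.src ∨ B14.Eq22Determines.blockIter k x = c.tgt} then g₀ else 0))
        ≤ 2 * ((F.P K).d : ℝ) * g₀) := by
  refine ⟨fun c bb => by split_ifs <;> [exact hg₀; exact le_rfl], fun A hA bb X c => ?_, fun bb => sum_indicator_cone_le _ hg₀⟩
  by_cases hmem : (bondToLit (F.P K) 0).symm bb ∈ bondsIn 0 {x : Site (F.P K) 0 | B14.Eq22Determines.blockIter k x = c.src ∨ B14.Eq22Determines.blockIter k x = c.tgt}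
  · rw [if_pos hmem]; exact hg A hA bb X c hmem
  · rw [if_neg hmem, zero_mul, zero_mul,
      equiv_fderiv_CslprOfRecord_single_eq_zero F N k Ω U₀ hk 𝔥 levB hU₀ (cone_saturated hk c) (hmap _ (cone_saturated hk c)) (hderiv _ (cone_saturated hk c))
        (mem_bondsIn_cone_self hk c) hmem A X, norm_zero]

/-! ## §2  Prop. 4 at the record (node-00), framed, from (ℓa-H)ᵖʳ + (KL-H)ᵖʳ + (KL-N)ᵖʳ + the on-cone entry letter + (14) -/

/-- ★★★ **[B11] PROP. 4 (97)–(98) AT THE RECORD IN THE NODE-00 REGIME FROM (ℓa-H) + (KL-H) + (KL-N) + THE ON-CONE ENTRY LETTER OF `D C^{𝔰𝔩}` + PRINT's (14)** (`0 < k ≤ m + K`, every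
site in `Ω_k`): FRAMED twin of ✓`prop4UniformAtRecord_node00_of_coneLetter`: G1ᵖʳ's door ✓`prop4UniformPrAtRecord_node00_of_kernelLetters` with its (KL-C)ᵖʳ block supplied by §1 from the PER-ENTRY letter
«`‖(D C^{sl,pr}(A)·δ_b X)(c)‖ ≤ g₀‖A‖‖X‖` for `b` in
the two-block cone of `c`, `‖A‖ < 2r`» ([B7] (157)'s shape, `g₀` playing `C₃η^d`) and the window `2r·Θ_H·(2d·g₀) ≤ ½`; `G := 2d·g₀` inside the `θ`'s.  Every constant a closed term.
HONEST: glue; the entry letter `g₀`, (ℓa-H)ᵖʳ, (KL-H)ᵖʳ, (KL-N)ᵖʳ, the frame bounds `hc`∕(hdom)∕(hnear) and the frame block-locality (hmap)∕(hderiv) are DISPLAYED, not proved. [cite: Balaban1985Variational, Prop. 4 (97)–(98) pp.292–293, (14) p.280, (73) p.289, (86)–(89) p.291; Balaban1985Averaging, Proposition 5 (157) p.42, p.24; Balaban1985BackgroundPropagators, (3.132) p.422] -/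
theorem prop4UniformPrAtRecord_node00_of_coneLetterPr [Fact (0 < c0Rec F K k)] [Fact (∀ c, 0 < wBRec F K k c)] [DecidableEq (PBond (F.P K) k)]
    (𝔥 : FrameDatum (F.P K) N k U₀) (levB : PBond (F.P K) k → ℕ) (a : ℝ)
    (hpos : ∀ x, x ≠ 0 → 0 < RCLike.re ⟪x, laplaceAOfRecord F N k U₀ (QprOfRecord F N k U₀ 𝔥) (QprimeOfRecord F N k U₀) a x⟫_ℂ)
    (hQ : Function.Surjective (QprOfRecord F N k U₀ 𝔥))
    (Gp : SiteL2K ℂ (F.P K).d (fun _ => (F.P K).sitesPerDir 0) (c0Rec F K k) (WRec N) →ₗ[ℂ]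
      SiteL2K ℂ (F.P K).d (fun _ => (F.P K).sitesPerDir 0) (c0Rec F K k) (WRec N))
    {b α nJ : ℝ} (hkpos : 0 < k) (hkm : k ≤ (F.P K).m + (F.P K).K) (hb : 0 ≤ b) (hΩ : ∀ x, x ∈ Ω k) (hα0 : 0 ≤ α) (hα : α * (11000000 * N) ≤ 1)
    (hreg : ∀ j, j < k → PlaqSmall (α * ((F.L : ℝ) ^ j * (F.P K).eta k) ^ 2) (Averaging.iter (avOfRecord F N K) j U₀))
    {c𝔥 : ℝ} (hc : c𝔥 ≤ 1000)
    (hdom : ∀ Y : PBond (F.P K) 0 → Matrix (Fin N) (Fin N) ℂ, (∀ b, (Y b).trace = 0) → (F.L : ℝ) ^ k * ‖Y‖ < 1 / (25000000000 * (F.L : ℝ) * N) →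
      expOver U₀ Y ∈ 𝔥.dom)
    (hnear : ∀ Y : PBond (F.P K) 0 → Matrix (Fin N) (Fin N) ℂ, (∀ b, (Y b).trace = 0) → (F.L : ℝ) ^ k * ‖Y‖ < 1 / (25000000000 * (F.L : ℝ) * N) →
      ∀ y : Site (F.P K) k, ‖𝔥.map (expOver U₀ Y) y - 1‖ ≤ c𝔥 * ((F.L : ℝ) ^ k * ‖Y‖) ∧ ‖𝔥.inv (expOver U₀ Y) y - 1‖ ≤ c𝔥 * ((F.L : ℝ) ^ k * ‖Y‖))
    (hmap : ∀ Y : Set (Site (F.P K) 0), (∀ i, i < k → ∀ s : Site (F.P K) i, toFine i s ∈ Y ↔ toFine (i + 1) (blockOf s) ∈ Y) →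
      ∀ V V' : PBond (F.P K) 0 → Matrix (Fin N) (Fin N) ℂ, (∀ b : PBond (F.P K) 0, b ∈ bondsIn 0 Y → V b = V' b) →
      ∀ y : Site (F.P K) k, toFine k y ∈ Y → 𝔥.map V y = 𝔥.map V' y ∧ 𝔥.inv V y = 𝔥.inv V' y)
    (hderiv : ∀ Y : Set (Site (F.P K) 0), (∀ i, i < k → ∀ s : Site (F.P K) i, toFine i s ∈ Y ↔ toFine (i + 1) (blockOf s) ∈ Y) →
      ∀ Z Z' : PBond (F.P K) 0 → Matrix (Fin N) (Fin N) ℂ, (∀ b : PBond (F.P K) 0, b ∈ bondsIn 0 Y → Z b = Z' b) →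
      ∀ y : Site (F.P K) k, toFine k y ∈ Y → 𝔥.deriv Z y = 𝔥.deriv Z' y)
    (hH : Prop4LetterHPrAtRecord F N K k Ω U₀ 𝔥 levB a hpos hQ b)
    -- (KL-H)
    {hk : Bond (F.P K).d (fun _ => (F.P K).sitesPerDir 0) → PBond (F.P K) k → ℝ} (hk0 : ∀ b' y, 0 ≤ hk b' y)
    (hHk : ∀ (y : PBond (F.P K) k) (Z : Matrix (Fin N) (Fin N) ℂ) (b' : Bond (F.P K).d (fun _ => (F.P K).sitesPerDir 0)),
      ‖flat115 (H1prOfRecordAtBg F N K k Ω U₀ 𝔥 levB a hpos hQ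
          ((NegSup.equiv (levWeight (F.L : ℝ) ((F.P K).eta k) levB 0) (Matrix (Fin N) (Fin N) ℂ)).symm (Pi.single y Z))) b'‖ ≤ hk b' y * ‖Z‖)
    {ΘH : ℝ} (hΘH : 0 ≤ ΘH) (hH1 : ∀ y, ∑ b', hk b' y ≤ ΘH) {ΘHw : ℝ} (hΘHw : 0 ≤ ΘHw)
    (hHw : ∀ (bb : Bond (F.P K).d (fun _ => (F.P K).sitesPerDir 0)) (y : PBond (F.P K) k),
      ∑ b', levWeight (F.L : ℝ) ((F.P K).eta k) (bondLevLit F Ω k) 3 bb / levWeight (F.L : ℝ) ((F.P K).eta k) (bondLevLit F Ω k) 3 b' * hk b' y ≤ ΘHw)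
    -- the ON-CONE ENTRY LETTER of `D C^{sl}` ([B7] (157)'s shape) on `‖A‖ < 2r`, and the window
    {g₀ : ℝ} (hg₀ : 0 ≤ g₀)
    (hg : letI C₂ : ℝ := 32000000000000000 * (F.L : ℝ) * N
      letI c₄ : ℝ := 1 / (200000000000 * (F.L : ℝ) * N)
      letI r : ℝ := min (c₄ / 4) (min (1 / 2) (1 / (16 * (b * C₂ + 1))))
      ∀ A : Space115Lit F N K k Ω U₀, ‖A‖ < r + r → ∀ (bb : Bond (F.P K).d (fun _ => (F.P K).sitesPerDir 0)) (X : Matrix (Fin N) (Fin N) ℂ) (c : PBond (F.P K) k),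
      (bondToLit (F.P K) 0).symm bb ∈ bondsIn 0 {x : Site (F.P K) 0 | B14.Eq22Determines.blockIter k x = c.src ∨ B14.Eq22Determines.blockIter k x = c.tgt} →
      ‖NegSup.equiv (levWeight (F.L : ℝ) ((F.P K).eta k) levB 0) (Matrix (Fin N) (Fin N) ℂ)
        (fderiv ℂ (CslprOfRecord F N K k Ω U₀ 𝔥 levB) A
          (single115 (lev₁ := pairLevLit F Ω k) (Dc := nabla115 ((F.P K).eta k) (unitsOfRecord F N U₀)) bb X)) c‖ ≤ g₀ * ‖A‖ * ‖X‖)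
    (hq : letI C₂ : ℝ := 32000000000000000 * (F.L : ℝ) * N
      letI c₄ : ℝ := 1 / (200000000000 * (F.L : ℝ) * N)
      letI r : ℝ := min (c₄ / 4) (min (1 / 2) (1 / (16 * (b * C₂ + 1))))
      (r + r) * ΘH * (2 * ((F.P K).d : ℝ) * g₀) ≤ 1 / 2)
    -- (KL-N)
    {hk' : Bond (F.P K).d (fun _ => (F.P K).sitesPerDir 0) → PBond (F.P K) k → ℝ} (hk'0 : ∀ b' y, 0 ≤ hk' b' y)
    (hNk : ∀ (y : PBond (F.P K) k) (Z : Matrix (Fin N) (Fin N) ℂ) (b' : Bond (F.P K).d (fun _ => (F.P K).sitesPerDir 0)),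
      ‖NegSup.equiv (levWeight (F.L : ℝ) ((F.P K).eta k) (bondLevLit F Ω k) 3) (Matrix (Fin N) (Fin N) ℂ)
        (DeltaPiCurOfRecord F N K k Ω U₀ Gp (QprimeOfRecord F N k U₀) (H1prOfRecordAtBg F N K k Ω U₀ 𝔥 levB a hpos hQ
          ((NegSup.equiv (levWeight (F.L : ℝ) ((F.P K).eta k) levB 0) (Matrix (Fin N) (Fin N) ℂ)).symm (Pi.single y Z)))) b'‖ ≤ hk' b' y * ‖Z‖)
    {Θ' : ℝ} (hΘ'0 : 0 ≤ Θ')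
    (hΘ' : ∀ (bb : Bond (F.P K).d (fun _ => (F.P K).sitesPerDir 0)) (y : PBond (F.P K) k),
      ∑ b', levWeight (F.L : ℝ) ((F.P K).eta k) (bondLevLit F Ω k) 3 bb / levWeight (F.L : ℝ) ((F.P K).eta k) (bondLevLit F Ω k) 1 b' * hk' b' y ≤ Θ')
    {N₁ : ℝ} (hN₁0 : 0 ≤ N₁)
    (hN₁ : ∀ b', ∑ y, levWeight (F.L : ℝ) ((F.P K).eta k) (bondLevLit F Ω k) 3 b' / levWeight (F.L : ℝ) ((F.P K).eta k) levB 0 y * hk' b' y ≤ N₁)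
    (hJ : ‖JOfRecordAtBg F N K k Ω U₀‖ ≤ nJ) :
    letI C₂ : ℝ := 32000000000000000 * (F.L : ℝ) * N
    letI c₄ : ℝ := 1 / (200000000000 * (F.L : ℝ) * N)
    letI r : ℝ := min (c₄ / 4) (min (1 / 2) (1 / (16 * (b * C₂ + 1))))
    letI R' : ℝ := min r ((1 - 4 * b * C₂ * (r + r)) * (1 / 16))
    letI CV : ℝ := 1024 * (((F.P K).d - 1 : ℕ) : ℝ) * ((1 : ℝ) * 1) ^ 3 * N * (α * (1 : ℝ) ^ 2 + 1 / 16)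
        + (((F.P K).d - 1 : ℕ) : ℝ) * ((1 : ℝ) * 1) ^ 3 * (136 + 2 * ((1 : ℝ) * 1)) * N
    letI G : ℝ := 2 * ((F.P K).d : ℝ) * g₀
    letI θ₃ : ℝ := (2 * (1 / (1 - 4 * b * C₂ * (r + r))) + 1) * ΘHw * G / r
    letI θE : ℝ := 2 * ΘHw * G * (1 / (1 - 4 * b * C₂ * (r + r)))
    letI θE' : ℝ := 2 * Θ' * G * (1 / (1 - 4 * b * C₂ * (r + r)))
    Prop4UniformPrAtRecord F N K k Ω U₀ 𝔥 levB a hpos hQ r Gp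
      ((N * θ₃ * nJ + (N₁ * C₂ * (1 / (1 - 4 * b * C₂ * (r + r))) ^ 2 + N * θE')
        + N * θE * (N₁ * C₂ * (1 / (1 - 4 * b * C₂ * (r + r))) ^ 2) * R'
        + N * (1 + θE * R') * CV * (1 / (1 - 4 * b * C₂ * (r + r))) ^ 2)) R' := by
  have hU₀ : SmallBelow (avOfRecord F N K) k U₀ := (loopProfile_of_regular_below F N k U₀ le_rfl hα0 hα hreg).1
  obtain ⟨hgC0, hCg, hG⟩ := kernelLetterC_of_conePr F N K k Ω U₀ hkm 𝔥 levB hU₀ hmap hderiv hg₀ hg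
  have hG0 : 0 ≤ 2 * ((F.P K).d : ℝ) * g₀ := by positivity
  exact prop4UniformPrAtRecord_node00_of_kernelLetters F N K k Ω U₀ 𝔥 levB a hpos hQ Gp hkpos hb hΩ hα0 hα hreg hc hdom hnear hH hk0 hHk hΘH hH1 hΘHw hHw hgC0 hCg hG0 hG hq
    hk'0 hNk hΘ'0 hΘ' hN₁0 hN₁ hJ

end Record

end Summit.QuantumFields.YangMills.Theorems.C44IterMh

end
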